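import Literature.AlgebraicGeometry.Frobenioids.DivisorMonoidCategoryTheoreticityProofs
import Literature.AlgebraicGeometry.Frobenioids.DivisorMonoidBirationalProp48
import Literature.AlgebraicGeometry.Frobenioids.BiratLocalization
import Literature.AlgebraicGeometry.Frobenioids.BaseSectionsOfObjectsCor57NonVacuity
import Literature.AlgebraicGeometry.Frobenioids.PadicFrobenioidCZeroSlim
import Literature.AlgebraicGeometry.Frobenioids.Thm49Padic
import HarnessLib

/-!
# Frobenioids I, §4: Proposition 4.1 (i)–(v), Definition 4.5 (iv) and Proposition 4.8 (ii) AS TYPED, at the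
# genuine carriers `C_{K/F}` ([FrdI] Ex. 6.3) and the `p`-adic Frobenioids of [FrdII] Ex. 1.1 — hypothesis-free

Mochizuki, *The geometry of Frobenioids I: the general theory*, Kyushu J. Math. **62** (2008) 293–400, §4,
Proposition 4.1 pp. 75–77, Definition 4.5 (iv) p. 86, Proposition 4.8 (ii) p. 88
[cite: MochizukiFrdI2008, Prop. 4.1 p.75] [cite: MochizukiFrdI2008, Def. 4.5 (iv) p.86]
[cite: MochizukiFrdI2008, Prop. 4.8 (ii) p.88]; the carriers: the arithmetic Frobenioid `C_{K/F}` of a Galois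
extension `K/F` of a number field (Example 6.3 / Theorem 6.4 (i) pp. 113–114 [cite: MochizukiFrdI2008, Thm. 6.4 (i) p.114])
and the `p`-adic Frobenioid of a datum `d : PadicFrd.Datum D p`, in particular THE `C₀(p)` over `D₀ = B(G_{ℚ_p})⁰`
(Mochizuki, *The geometry of Frobenioids II*, Example 1.1 (i)/(ii) pp. 7–8 [cite: MochizukiFrdII2008, Ex 1.1 (i) p.7]).

PROOF-ONLY file (abc-iut cell, D-0079 L-F [FrdI/II] sub-cell, LF-FRD rows F-1038 … F-1043 `Prop41*`, F-1049
`Prop48ii`, F-2341 `IsDivSlim`; seat abc-iut-L1-t14), 0 definitions. The named statements of seat abc-iut-L1-t3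
(`DivisorMonoidCategoryTheoreticityDefs.lean`) are SCHEMAS over a `PreFrobenioidData` (resp. a birationalization
datum `B`); their print-generality closers are this lineage's `PreFrobenioidData.prop41*_holds` (every Frobenioid
`F : C ⥤ F_Φ`, `Φ` perf-factorial — exactly the standing assumptions of §4, p. 75) and abc-iut-L6-t20's
`PreFrobenioid.prop48ii_biratData` (THE birationalization `biratData hF hsq`). Here:

* the birat-squares binder `hsq` of `prop48ii_biratData` is discharged for every Frobenioid
  (`PreFrobenioid.hasBiratSquares_of_isFrobenioid`): `PreFrobenioid.prop48ii_biratData_of_isFrobenioid`;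
* every schema is stated HYPOTHESIS-FREE at `C_{K/F}` (operations `arithFrobenioidOps F K`; inputs
  `arithFrobenioid_isFrobenioid` = Thm. 5.2 (ii)/6.4, `arith_objectwise_isPerfFactorial`), at the `p`-adic
  Frobenioid of a datum with monoid data (`d.isFrobenioid_of_isMonoidData`, `PadicFrd.padic_objectwise_isPerfFactorial`),
  and with NO input at all at THE `C₀(p)` (`PadicFrd.czeroGal_isFrobenioid`);
* Def. 4.5 (iv) at `C₀(p)`: `D₀` is slim (`PadicFrd.dZero_isSlim`, [FrdII] Thm. 1.2 (iv)), hence Div-slim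
  ("[Thus, if `D` is slim, then it is Div-slim.]", `PreFrobenioidData.isDivSlim_of_isSlim`); at `C_{K/F}` this is
  abc-iut-L6-t10's `arithFrobenioidOps_isDivSlim` (Thm. 6.4 (i)), cited, not restated.

No statement of either paper is restated or strengthened; nothing here bears on, or takes a side on,
[IUTchIII] Cor. 3.12.
-/

noncomputable section

namespace Literature.AlgebraicGeometry.Frobenioids

open CategoryTheory Opposite

universe w v v' u u'

/-! ### Proposition 4.8 (ii) at THE birationalization of every Frobenioid (the birat-squares binder discharged) -/

namespace PreFrobenioid

variable {D : Type u} [Category.{v} D] {Φ : Dᵒᵖ ⥤ CommMonCat.{w}} {C : Type u'} [Category.{v'} C]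
  {F : C ⥤ ElemFrobenioid Φ}

/-- **[FrdI] Prop. 4.8 (ii)** AS TYPED (`Prop48ii`) at THE birationalization of a Frobenioid `F : C ⥤ F_Φ`, with
the only input "`C` is a Frobenioid" (Def. 1.3): the composition squares of Prop. 4.4 (i) exist in every
Frobenioid (`hasBiratSquares_of_isFrobenioid`). [cite: MochizukiFrdI2008, Prop. 4.8 (ii) p.88] -/
theorem prop48ii_biratData_of_isFrobenioid (hF : IsFrobenioid F) :
    (PreFrobenioidData.ofFunctor Φ F).Prop48ii (biratData hF (hasBiratSquares_of_isFrobenioid hF)) :=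
  prop48ii_biratData hF (hasBiratSquares_of_isFrobenioid hF)

end PreFrobenioid

/-! ### At the arithmetic Frobenioid `C_{K/F}` of [FrdI] Example 6.3 — nothing assumed -/

section Arith

variable (F : Type) [Field F] [NumberField F] (K : Type) [Field K] [Algebra F K] [IsGalois F K]

/-- **[FrdI] Prop. 4.1 (i)** AS TYPED at `C_{K/F}`, for every object `A` and every family `α`, hypothesis-free
(`C_{K/F}` is a Frobenioid, Thm. 6.4). [cite: MochizukiFrdI2008, Prop. 4.1 (i) p.75] -/
theorem prop41i_arith (A : arithFrobenioid F K) (α : ℕ+ → End A) : (arithFrobenioidOps F K).Prop41i A α :=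
  PreFrobenioidData.prop41i_holds (arithFrobenioid_isFrobenioid F K) A α

/-- **[FrdI] Prop. 4.1 (ii)** AS TYPED at `C_{K/F}`, hypothesis-free (`Φ` perf-factorial objectwise,
`arith_objectwise_isPerfFactorial`). [cite: MochizukiFrdI2008, Prop. 4.1 (ii) p.75] -/
theorem prop41ii_arith (A : arithFrobenioid F K) (α : ℕ+ → End A) : (arithFrobenioidOps F K).Prop41ii A α :=
  PreFrobenioidData.prop41ii_holds (arithFrobenioid_isFrobenioid F K) (arith_objectwise_isPerfFactorial F K) A α

/-- **[FrdI] Prop. 4.1 (iii)**, criterion, AS TYPED at `C_{K/F}` with "disjoint supports" = disjointness of the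
supports (Def. 2.4 (i)(d)) of the images in `Φ(F)^pf`, hypothesis-free. [cite: MochizukiFrdI2008, Prop. 4.1 (iii) p.75] -/
theorem prop41iii_criterion_arith :
    (arithFrobenioidOps F K).Prop41iii_criterion fun {X} (y y' : (arithDivisorFunctor F K).obj (op X)) =>
      Disjoint (supp (factorMap _ (Perfection.of _ y))) (supp (factorMap _ (Perfection.of _ y'))) :=
  PreFrobenioidData.prop41iii_criterion_holds (arithFrobenioid_isFrobenioid F K)
    (arith_objectwise_isPerfFactorial F K)

/-- **[FrdI] Prop. 4.1 (iii)**, cartesian square, AS TYPED at `C_{K/F}`, hypothesis-free.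
[cite: MochizukiFrdI2008, Prop. 4.1 (iii) p.75] -/
theorem prop41iii_square_arith : (arithFrobenioidOps F K).Prop41iii_square :=
  PreFrobenioidData.prop41iii_square_holds (arithFrobenioid_isFrobenioid F K)
    (arith_objectwise_isPerfFactorial F K)

/-- **[FrdI] Prop. 4.1 (iv)** AS TYPED at `C_{K/F}`, hypothesis-free. [cite: MochizukiFrdI2008, Prop. 4.1 (iv) p.76] -/
theorem prop41iv_arith : (arithFrobenioidOps F K).Prop41iv :=
  PreFrobenioidData.prop41iv_holds (arithFrobenioid_isFrobenioid F K) (arith_objectwise_isPerfFactorial F K)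

/-- **[FrdI] Prop. 4.1 (v)** AS TYPED at `C_{K/F}`, hypothesis-free. [cite: MochizukiFrdI2008, Prop. 4.1 (v) p.76] -/
theorem prop41v_arith : (arithFrobenioidOps F K).Prop41v :=
  PreFrobenioidData.prop41v_holds (arithFrobenioid_isFrobenioid F K) (arith_objectwise_isPerfFactorial F K)

/-- **[FrdI] Prop. 4.8 (ii)** AS TYPED at THE birationalization of `C_{K/F}`, hypothesis-free.
[cite: MochizukiFrdI2008, Prop. 4.8 (ii) p.88] -/
theorem prop48ii_arith :
    (arithFrobenioidOps F K).Prop48ii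
      (PreFrobenioid.biratData (arithFrobenioid_isFrobenioid F K)
        (PreFrobenioid.hasBiratSquares_of_isFrobenioid (arithFrobenioid_isFrobenioid F K))) :=
  PreFrobenioid.prop48ii_biratData_of_isFrobenioid (arithFrobenioid_isFrobenioid F K)

end Arith

/-! ### At the `p`-adic Frobenioid of a datum `d : PadicFrd.Datum D p` ([FrdII] Ex. 1.1 (ii)) -/

namespace PadicFrd

section Datum

variable {D : Type u} [Category.{v} D] {p : ℕ} [Fact p.Prime] (d : Datum D p)

/-- **[FrdI] Prop. 4.1 (i)** AS TYPED at the `p`-adic Frobenioid of a datum with monoid data ("`Φ`, `B` monoids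
on `D`", [FrdII] Ex. 1.1 (ii); then `C` is a Frobenioid by [FrdI] Thm. 5.2 (ii)). [cite: MochizukiFrdI2008, Prop. 4.1 (i) p.75] -/
theorem prop41i_padic (h : d.IsMonoidData) (A : d.frobenioid) (α : ℕ+ → End A) :
    (ModelFrobenioid.data d.Φ d.B d.divB).Prop41i A α :=
  PreFrobenioidData.prop41i_holds (d.isFrobenioid_of_isMonoidData h) A α

/-- **[FrdI] Prop. 4.1 (ii)** AS TYPED at the `p`-adic Frobenioid of a datum with monoid data (`Φ` perf-factorial:
each `Φ(A)` is monoprime, `padic_objectwise_isPerfFactorial`). [cite: MochizukiFrdI2008, Prop. 4.1 (ii) p.75] -/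
theorem prop41ii_padic (h : d.IsMonoidData) (A : d.frobenioid) (α : ℕ+ → End A) :
    (ModelFrobenioid.data d.Φ d.B d.divB).Prop41ii A α :=
  PreFrobenioidData.prop41ii_holds (d.isFrobenioid_of_isMonoidData h) (padic_objectwise_isPerfFactorial d) A α

/-- **[FrdI] Prop. 4.1 (iii)**, criterion, AS TYPED at the `p`-adic Frobenioid of a datum with monoid data.
[cite: MochizukiFrdI2008, Prop. 4.1 (iii) p.75] -/
theorem prop41iii_criterion_padic (h : d.IsMonoidData) :
    (ModelFrobenioid.data d.Φ d.B d.divB).Prop41iii_criterion fun {X} (y y' : d.Φ.obj (op X)) =>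
      Disjoint (supp (factorMap _ (Perfection.of _ y))) (supp (factorMap _ (Perfection.of _ y'))) :=
  PreFrobenioidData.prop41iii_criterion_holds (d.isFrobenioid_of_isMonoidData h)
    (padic_objectwise_isPerfFactorial d)

/-- **[FrdI] Prop. 4.1 (iii)**, cartesian square, AS TYPED at the `p`-adic Frobenioid of a datum with monoid data.
[cite: MochizukiFrdI2008, Prop. 4.1 (iii) p.75] -/
theorem prop41iii_square_padic (h : d.IsMonoidData) : (ModelFrobenioid.data d.Φ d.B d.divB).Prop41iii_square :=
  PreFrobenioidData.prop41iii_square_holds (d.isFrobenioid_of_isMonoidData h) (padic_objectwise_isPerfFactorial d)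

/-- **[FrdI] Prop. 4.1 (iv)** AS TYPED at the `p`-adic Frobenioid of a datum with monoid data.
[cite: MochizukiFrdI2008, Prop. 4.1 (iv) p.76] -/
theorem prop41iv_padic (h : d.IsMonoidData) : (ModelFrobenioid.data d.Φ d.B d.divB).Prop41iv :=
  PreFrobenioidData.prop41iv_holds (d.isFrobenioid_of_isMonoidData h) (padic_objectwise_isPerfFactorial d)

/-- **[FrdI] Prop. 4.1 (v)** AS TYPED at the `p`-adic Frobenioid of a datum with monoid data.
[cite: MochizukiFrdI2008, Prop. 4.1 (v) p.76] -/
theorem prop41v_padic (h : d.IsMonoidData) : (ModelFrobenioid.data d.Φ d.B d.divB).Prop41v :=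
  PreFrobenioidData.prop41v_holds (d.isFrobenioid_of_isMonoidData h) (padic_objectwise_isPerfFactorial d)

/-- **[FrdI] Prop. 4.8 (ii)** AS TYPED at THE birationalization of the `p`-adic Frobenioid of a datum with monoid
data. [cite: MochizukiFrdI2008, Prop. 4.8 (ii) p.88] -/
theorem prop48ii_padic (h : d.IsMonoidData) :
    (ModelFrobenioid.data d.Φ d.B d.divB).Prop48ii
      (PreFrobenioid.biratData (d.isFrobenioid_of_isMonoidData h)
        (PreFrobenioid.hasBiratSquares_of_isFrobenioid (d.isFrobenioid_of_isMonoidData h))) :=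
  PreFrobenioid.prop48ii_biratData_of_isFrobenioid (d.isFrobenioid_of_isMonoidData h)

end Datum

/-! ### At THE `p`-adic Frobenioid `C₀(p)` over `D₀ = B(G_{ℚ_p})⁰` ([FrdII] Ex. 1.1 (i)) — nothing assumed -/

section CZero

variable (p : ℕ) [Fact p.Prime]

/-- **[FrdI] Prop. 4.1 (i)** AS TYPED at THE `C₀(p)`, hypothesis-free. [cite: MochizukiFrdI2008, Prop. 4.1 (i) p.75] -/
theorem prop41i_czeroGal (A : CZeroGal p) (α : ℕ+ → End A) :
    (ModelFrobenioid.data (Datum.zeroGal p).Φ (Datum.zeroGal p).B (Datum.zeroGal p).divB).Prop41i A α :=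
  prop41i_padic (Datum.zeroGal p) (zeroGal_isMonoidData p) A α

/-- **[FrdI] Prop. 4.1 (ii)** AS TYPED at THE `C₀(p)`, hypothesis-free. [cite: MochizukiFrdI2008, Prop. 4.1 (ii) p.75] -/
theorem prop41ii_czeroGal (A : CZeroGal p) (α : ℕ+ → End A) :
    (ModelFrobenioid.data (Datum.zeroGal p).Φ (Datum.zeroGal p).B (Datum.zeroGal p).divB).Prop41ii A α :=
  prop41ii_padic (Datum.zeroGal p) (zeroGal_isMonoidData p) A α

/-- **[FrdI] Prop. 4.1 (iii)**, criterion, AS TYPED at THE `C₀(p)`, hypothesis-free.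
[cite: MochizukiFrdI2008, Prop. 4.1 (iii) p.75] -/
theorem prop41iii_criterion_czeroGal :
    (ModelFrobenioid.data (Datum.zeroGal p).Φ (Datum.zeroGal p).B (Datum.zeroGal p).divB).Prop41iii_criterion
      fun {X} (y y' : (Datum.zeroGal p).Φ.obj (op X)) =>
        Disjoint (supp (factorMap _ (Perfection.of _ y))) (supp (factorMap _ (Perfection.of _ y'))) :=
  prop41iii_criterion_padic (Datum.zeroGal p) (zeroGal_isMonoidData p)

/-- **[FrdI] Prop. 4.1 (iii)**, cartesian square, AS TYPED at THE `C₀(p)`, hypothesis-free.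
[cite: MochizukiFrdI2008, Prop. 4.1 (iii) p.75] -/
theorem prop41iii_square_czeroGal :
    (ModelFrobenioid.data (Datum.zeroGal p).Φ (Datum.zeroGal p).B (Datum.zeroGal p).divB).Prop41iii_square :=
  prop41iii_square_padic (Datum.zeroGal p) (zeroGal_isMonoidData p)

/-- **[FrdI] Prop. 4.1 (iv)** AS TYPED at THE `C₀(p)`, hypothesis-free. [cite: MochizukiFrdI2008, Prop. 4.1 (iv) p.76] -/
theorem prop41iv_czeroGal :
    (ModelFrobenioid.data (Datum.zeroGal p).Φ (Datum.zeroGal p).B (Datum.zeroGal p).divB).Prop41iv :=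
  prop41iv_padic (Datum.zeroGal p) (zeroGal_isMonoidData p)

/-- **[FrdI] Prop. 4.1 (v)** AS TYPED at THE `C₀(p)`, hypothesis-free. [cite: MochizukiFrdI2008, Prop. 4.1 (v) p.76] -/
theorem prop41v_czeroGal :
    (ModelFrobenioid.data (Datum.zeroGal p).Φ (Datum.zeroGal p).B (Datum.zeroGal p).divB).Prop41v :=
  prop41v_padic (Datum.zeroGal p) (zeroGal_isMonoidData p)

/-- **[FrdI] Prop. 4.8 (ii)** AS TYPED at THE birationalization of THE `C₀(p)`, hypothesis-free.
[cite: MochizukiFrdI2008, Prop. 4.8 (ii) p.88] -/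
theorem prop48ii_czeroGal :
    (ModelFrobenioid.data (Datum.zeroGal p).Φ (Datum.zeroGal p).B (Datum.zeroGal p).divB).Prop48ii
      (PreFrobenioid.biratData (czeroGal_isFrobenioid p)
        (PreFrobenioid.hasBiratSquares_of_isFrobenioid (czeroGal_isFrobenioid p))) :=
  PreFrobenioid.prop48ii_biratData_of_isFrobenioid (czeroGal_isFrobenioid p)

/-- **[FrdI] Def. 4.5 (iv) at THE `C₀(p)`**: `D₀ = B(G_{ℚ_p})⁰` is Div-slim with respect to `Φ_{C₀}` — `D₀` is
slim ([FrdII] Thm. 1.2 (iv), `dZero_isSlim`), "thus … Div-slim" (FrdI p. 86), hypothesis-free.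
[cite: MochizukiFrdI2008, Def. 4.5 (iv) p.86] -/
theorem isDivSlim_czeroGal :
    (ModelFrobenioid.data (Datum.zeroGal p).Φ (Datum.zeroGal p).B (Datum.zeroGal p).divB).IsDivSlim :=
  PreFrobenioidData.isDivSlim_of_isSlim _ (dZero_isSlim p)

end CZero

end PadicFrd

end Literature.AlgebraicGeometry.Frobenioids

end
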